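import Summits.CriticalPhenomena.CardyFormulaZ2.Theorems.UniformBoxCrossing.Negative.FalseWithoutFKG
import Literature.Probability.Percolation.LongRangeKernelPercolationProofs
import HarnessLib

/-!
# Uniformity is load-bearing: no box-crossing constants serve the half-open segment `s ∈ [0, 1)`
(negative-side support for crux `UniformBoxCrossing`, stmt-CriticalPhenomena-5476; cdisprove findings
`Cruxes/UniformBoxCrossing/Disproof.lean` §2b, landed verbatim by the line lead; part 3 of 5)

Even with the laminated endpoint EXCLUDED, no constants `(c, n₀)` serve all `s ∈ [0, 1)` at aspect
ratio 8 (`not_uniform_boxCrossingBounds_below_lamination`): finite-volume crossing probabilities are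
continuous in `s` (`determinedBy_preimage_embRectCrossing` + the tree's
`continuous_prodBernoulli_real_of_determinedBy`), so uniform bounds would pass to `s = 1`, which part 2
excludes. So on this family "RSW pointwise but not uniformly" is real next door to the crux: uniform
constants on the FKG segment must come from a quantitative use of `t ≤ 1`, not from compactness plus
pointwise RSW.
-/

namespace Summit.CriticalPhenomena.CardyFormulaZ2.Theorems.UniformBoxCrossing.Negative

open MeasureTheory Filter Literature.Probability.Percolation Literature.Probability.LatticeModels
open Summit.CriticalPhenomena.CardyFormulaZ2.Theses.CardySelfDualSegment
open scoped Topology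

noncomputable section

/-! ### Uniformity is load-bearing: no constants serve the half-open segment `s ∈ [0, 1)` -/

/-- A finite box of `ℤ²` containing every vertex of the strip-rectangle of the slack-2 crossing
event of `w + [0, a] × [0, b]` on `√2 ℤ²`. -/
def stripBox (w : ℂ) (a b : ℝ) : Finset (Site 2) :=
  Finset.Icc ![⌊(w.re - 2) / Real.sqrt 2⌋, ⌊w.im / Real.sqrt 2⌋]
    ![⌈(w.re + a + 2) / Real.sqrt 2⌉, ⌈(w.im + b) / Real.sqrt 2⌉]

/-- The strip-rectangle lies in the strip box. -/
theorem mem_stripBox {w : ℂ} {a b : ℝ} {v : Site 2}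
    (hre : (squareLatticeEmbedding.z v - w).re ∈ Set.Icc (-2 : ℝ) (a + 2))
    (him : (squareLatticeEmbedding.z v - w).im ∈ Set.Icc (0 : ℝ) b) : v ∈ stripBox w a b := by
  have hr0 : (0 : ℝ) < Real.sqrt 2 := by positivity
  simp only [Complex.sub_re, Complex.sub_im, TrackExchange.zsq_re, TrackExchange.zsq_im,
    Set.mem_Icc] at hre him
  have h1 : ⌊(w.re - 2) / Real.sqrt 2⌋ ≤ v 0 := by
    have : (w.re - 2) / Real.sqrt 2 ≤ v 0 := by rw [div_le_iff₀ hr0]; linarith [hre.1]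
    exact_mod_cast (Int.floor_le _).trans this |> fun h => Int.cast_le.1 (h.trans_eq rfl)
  have h2 : (v 0 : ℤ) ≤ ⌈(w.re + a + 2) / Real.sqrt 2⌉ := by
    have : (v 0 : ℝ) ≤ (w.re + a + 2) / Real.sqrt 2 := by rw [le_div_iff₀ hr0]; linarith [hre.2]
    exact Int.cast_le.1 (this.trans (Int.le_ceil _))
  have h3 : ⌊w.im / Real.sqrt 2⌋ ≤ v 1 := by
    have : w.im / Real.sqrt 2 ≤ v 1 := by rw [div_le_iff₀ hr0]; linarith [him.1]
    exact Int.cast_le.1 ((Int.floor_le _).trans this)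
  have h4 : (v 1 : ℤ) ≤ ⌈(w.im + b) / Real.sqrt 2⌉ := by
    have : (v 1 : ℝ) ≤ (w.im + b) / Real.sqrt 2 := by rw [le_div_iff₀ hr0]; linarith [him.2]
    exact Int.cast_le.1 (this.trans (Int.le_ceil _))
  simp only [stripBox, Finset.mem_Icc, Pi.le_def, Fin.forall_fin_two, Matrix.cons_val_zero,
    Matrix.cons_val_one]
  exact ⟨⟨h1, h3⟩, h2, h4⟩

/-- **Locality of the corner map**: coin sets agreeing at the vertices of `T` induce the same open
subgraph on `T`. -/
theorem induce_openGraph_cornerConfig_eq {T : Set (Site 2)} {S S' : Set (Site 2 × Fin 2)}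
    (h : ∀ v ∈ T, ∀ j : Fin 2, (v, j) ∈ S ↔ (v, j) ∈ S') :
    (openGraph (cornerConfig S)).induce T = (openGraph (cornerConfig S')).induce T := by
  have key : ∀ (S S' : Set (Site 2 × Fin 2)), (∀ v ∈ T, ∀ j : Fin 2, (v, j) ∈ S ↔ (v, j) ∈ S') →
      ∀ a b : Site 2, a ∈ T → b ∈ T → s(a, b) ∈ cornerConfig S → s(a, b) ∈ cornerConfig S' := by
    intro S S' h a b ha hb hab
    rw [mem_cornerConfig_iff] at hab ⊢
    obtain ⟨v, hv⟩ := hab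
    have hvT : v ∈ T := by
      rcases hv with ⟨he, -⟩ | ⟨he, -⟩ <;>
      · rcases Sym2.eq_iff.1 he with ⟨rfl, -⟩ | ⟨-, rfl⟩
        · exact ha
        · exact hb
    refine ⟨v, ?_⟩
    rcases hv with ⟨he, hc⟩ | ⟨he, hc⟩
    · exact Or.inl ⟨he, (h v hvT 0).1 hc⟩
    · refine Or.inr ⟨he, ?_⟩
      rw [← h v hvT 0, ← h v hvT 1]
      exact hc
  ext a b
  simp only [SimpleGraph.induce_adj, openGraph, SimpleGraph.fromEdgeSet_adj]
  exact and_congr_left fun _ =>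
    ⟨key S S' h a b a.2 b.2, key S' S (fun v hv j => (h v hv j).symm) a b a.2 b.2⟩

/-- Open crossings inside `T` only see the open subgraph induced on `T`. -/
theorem openCrossing_congr_of_induce_eq {V : Type*} {T A B : Set V} {ω ω' : BondConfig V}
    (hG : (openGraph ω).induce T = (openGraph ω').induce T) :
    ω ∈ openCrossing T A B ↔ ω' ∈ openCrossing T A B := by
  simp only [mem_openCrossing_iff, openConnIn, Set.mem_setOf_eq, hG]

/-- The preimage under the corner map of a slack-2 horizontal crossing event on `√2 ℤ²` is
determined by the coins and splitting bits of the (finitely many) vertices of the strip box. -/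
theorem determinedBy_preimage_embRectCrossing (w : ℂ) (a b : ℝ) :
    DeterminedBy (cornerConfig ⁻¹' embRectCrossing (fun v => squareLatticeEmbedding.z v - w) a b)
      (↑(stripBox w a b ×ˢ (Finset.univ : Finset (Fin 2))) : Set (Site 2 × Fin 2)) := by
  rw [determinedBy_iff]
  intro S S' hSS'
  set T : Set (Site 2) := {v | (squareLatticeEmbedding.z v - w).re ∈ Set.Icc (-2 : ℝ) (a + 2) ∧
    (squareLatticeEmbedding.z v - w).im ∈ Set.Icc (0 : ℝ) b} with hT
  have hagree : ∀ v ∈ T, ∀ j : Fin 2, (v, j) ∈ S ↔ (v, j) ∈ S' := by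
    intro v hv j
    have hF : (v, j) ∈ (↑(stripBox w a b ×ˢ (Finset.univ : Finset (Fin 2))) : Set (Site 2 × Fin 2)) := by
      simp only [Finset.coe_product, Finset.coe_univ, Set.mem_prod, Finset.mem_coe, Set.mem_univ,
        and_true]
      exact mem_stripBox hv.1 hv.2
    constructor
    · intro hS
      exact ((Set.ext_iff.1 hSS' (v, j)).1 ⟨hS, hF⟩).1
    · intro hS'
      exact ((Set.ext_iff.1 hSS' (v, j)).2 ⟨hS', hF⟩).1
  exact openCrossing_congr_of_induce_eq (induce_openGraph_cornerConfig_eq hagree)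

/-- **Continuity in the splitting parameter** of every slack-2 crossing probability (finite volume:
a polynomial in `s`). -/
theorem continuous_extCornerPercolation_real_embRectCrossing (w : ℂ) (a b : ℝ) :
    Continuous fun s : unitInterval => (extCornerPercolation s).real
      (embRectCrossing (fun v => squareLatticeEmbedding.z v - w) a b) := by
  have hEm : MeasurableSet (embRectCrossing (fun v => squareLatticeEmbedding.z v - w) a b) :=
    measurableSet_openCrossing_of_countable _ _ _
  have h := continuous_prodBernoulli_real_of_determinedBy (fun s : unitInterval => extCornerParam s)
    (determinedBy_preimage_embRectCrossing w a b) (fun i _ => ?_)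
  · refine h.congr fun s => ?_
    rw [extCornerPercolation, map_measureReal_apply measurable_cornerConfig hEm]
  · rcases i with ⟨v, j⟩
    fin_cases j
    · exact continuous_const
    · simp only [Fin.mk_one, extCornerParam_apply_one]; exact continuous_subtype_val

/-- A sequence in `[0, 1)` converging to the laminated endpoint. -/
def belowOne (k : ℕ) : unitInterval :=
  ⟨1 - 1 / ((k : ℝ) + 2), by
    constructor
    · rw [sub_nonneg, div_le_one (by positivity)]; linarith
    · rw [sub_le_self_iff]; positivity⟩

/-- The sequence stays below `1`. -/
theorem belowOne_lt_one (k : ℕ) : belowOne k < 1 := by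
  change (1 - 1 / ((k : ℝ) + 2)) < 1
  have : (0 : ℝ) < 1 / ((k : ℝ) + 2) := by positivity
  linarith

/-- The sequence converges to `1`. -/
theorem tendsto_belowOne : Tendsto belowOne atTop (𝓝 1) := by
  rw [tendsto_subtype_rng]
  change Tendsto (fun k : ℕ => (1 - 1 / ((k : ℝ) + 2))) atTop (𝓝 (1 : ℝ))
  have h := (tendsto_one_div_add_atTop_nhds_zero_nat (𝕜 := ℝ)).comp (tendsto_add_atTop_nat 1)
  have h' : Tendsto (fun k : ℕ => 1 / ((k : ℝ) + 2)) atTop (𝓝 0) := by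
    refine h.congr fun k => ?_
    simp only [Function.comp_apply]; push_cast; ring
  simpa using (tendsto_const_nhds (x := (1 : ℝ))).sub h'

/-- **Uniformity is load-bearing.** Even with the laminated endpoint EXCLUDED, no constants serve
the half-open extended segment `s ∈ [0, 1)` at aspect ratio `8`: crossing probabilities of a fixed
box are continuous in `s` (finite volume), so uniform bounds on `[0, 1)` would pass to `s = 1`,
where `laminated_hardWay_le` forbids them. (Numerically each `M_s`, `s < 1`, looks box-crossing
with constants degenerating as `s → 1`; so positivity of RSW constants is NOT a consequence of the
soft structure shared by the whole family, and uniform constants on the FKG segment must come from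
a quantitative use of `t ≤ 1`.) -/
theorem not_uniform_boxCrossingBounds_below_lamination :
    ¬ ∃ c > 0, ∃ n₀ : ℕ, ∀ s : unitInterval, s < 1 →
      BoxCrossingBounds (extCornerPercolation s) squareLatticeEmbedding.z 8 c n₀ := by
  rintro ⟨c, hc, n₀, h⟩
  obtain ⟨N, hN⟩ := (tendsto_laminated_bound.eventually (gt_mem_nhds hc)).exists_forall_of_atTop
  set n := max N n₀ with hn
  set E := embRectCrossing (fun v => squareLatticeEmbedding.z v - 0) (8 * n) n with hE
  -- along `belowOne k → 1` the crossing probabilities are `≥ c` and converge to the value at `1`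
  have hk : ∀ k, c ≤ (extCornerPercolation (belowOne k)).real E := fun k =>
    (h (belowOne k) (belowOne_lt_one k) n (le_max_right _ _) 0).1.1
  have hlim : Tendsto (fun k => (extCornerPercolation (belowOne k)).real E) atTop
      (𝓝 ((extCornerPercolation 1).real E)) :=
    ((continuous_extCornerPercolation_real_embRectCrossing 0 (8 * n) n).tendsto 1).comp
      tendsto_belowOne
  have h1 : c ≤ (extCornerPercolation 1).real E := ge_of_tendsto' hlim hk
  have h2 := laminated_hardWay_le 0 n
  have h3 := hN n (le_max_left _ _)
  linarith


end

end Summit.CriticalPhenomena.CardyFormulaZ2.Theorems.UniformBoxCrossing.Negative
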